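import Mathlib
import HarnessLib
import Literature.MathematicalPhysics.QuantumFieldTheory.U1RepUnitaryModel
import Literature.MathematicalPhysics.QuantumFieldTheory.U1GinibreComparison
import Literature.MathematicalPhysics.QuantumFieldTheory.LatticeGaugeProofs
import Summits.QuantumFields.YangMills.Theorems.SoloBlindSinglePlaquette
import Summits.QuantumFields.YangMills.Theorems.SoloInformedU1Helicity

/-!
# The upper half of `WilsonU1PlaquetteSecondMomentD4`: `2β⟨sin²θ_p⟩_μ ≤ 1 + ε` at weak coupling

Route `U1DipoleHelicity` (LINE 4 of the ideator cell ym-idea-2; an abelian COMPARISON line onto the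
node `Theorems.U1HelicityGapD4`, not a rung of `YangMills`), helper for the crux item
stmt-QuantumFields-25881 `Summit.QuantumFields.YangMills.Theses.U1DipoleHelicity.WilsonU1PlaquetteSecondMomentD4`
(`|2β⟨sin²θ_{(0;0,1)}⟩_μ − 1| ≤ ε` for every weak-coupling limit state `μ` of Wilson `U(1)₄`).

This file proves the UPPER inequality of that crux, `2β⟨sin²θ_{(0;0,1)}⟩_μ ≤ 1 + ε`
(`wilsonU1PlaquetteSecondMoment_upper`), for every `ε > 0`, all `β > β₁(ε)` and every infinite-volume
torus limit state — which is the only half the route's `Assembly`/ε-budget consumes (it bounds the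
charge ratio `β/β′` from above through the dipole law at `z = 0` and `K(0) = 1/2`).
Mechanism: on the unit circle `sin²θ = (1 − cos θ)(1 + cos θ) ≤ 2(1 − cos θ)`, so on every torus
`⟨sin²θ_p⟩_{Λ_{M+1},β} ≤ 2⟨1 − cos θ_p⟩_{Λ_{M+1},β}` (`torusPlaqSinSq_le`), and the tree's
one-point theorem at weak coupling (`SoloBlind.weakCoupling_singlePlaquette`: Chatterjee's leading
free-energy term + Griffiths' convexity lemma, every torus side; `u1Rep` is a unitary model,
`isUnitaryModel_u1Rep`) gives `β⟨1 − cos θ_p⟩_{Λ_{M+1},β} ≤ 1/4 + ε/4` for large `β`, then large `M`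
(`torusPlaqSinSq_eventually_le`); the torus second moments converge to
`⟨sin²θ_p⟩_μ = U1Helicity.plaqCorr μ 0 0 1` along the defining subsequence of a limit state
(`tendsto_torusPlaqSinSq`).  The file imports no route (`Theses`) file: its statements are in the
tree's vocabulary (`U1Helicity.plaqCorr`, `infiniteVolumeLimitPoints`, `u1Rep`).

The LOWER inequality (`β⟨(1 − cos θ_p)²⟩_μ → 0`, a single-plaquette large-field tail uniform in the
volume) is not proved here: the tree's chessboard tail `WilsonPlaquetteTail.measureReal_plaquette_mem_le`
needs EVEN torus sides, while limit states run over all sides.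

Nothing here bears on the Yang–Mills mass gap: the line is the abelian comparison statement.
-/

noncomputable section

namespace Summit.QuantumFields.YangMills.Theorems.U1DipoleHelicity

open MeasureTheory Filter Topology
open Literature.MathematicalPhysics.QuantumLattice Literature.MathematicalPhysics.QuantumFieldTheory
open Summit.QuantumFields.YangMills.Theorems.U1Helicity

/-- On the unit circle, `(Im z)² ≤ 2(1 − Re z)` (`sin²θ = (1 − cos θ)(1 + cos θ)`). [folklore] -/
theorem circle_im_sq_le (z : Circle) : ((z : ℂ).im) ^ 2 ≤ 2 * (1 - (z : ℂ).re) := by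
  have h : (z : ℂ).re * (z : ℂ).re + (z : ℂ).im * (z : ℂ).im = 1 := by
    rw [← Complex.normSq_apply]; exact Circle.normSq_coe z
  nlinarith [sq_nonneg (1 - (z : ℂ).re)]

/-- **Torus second moment vs. plaquette cost**:
`⟨sin²θ_{(0;0,1)}⟩_{Λ_{M+1},β} ≤ 2⟨1 − Re tr u1Rep(U_{0,01})⟩_{Λ_{M+1},β} = 2⟨1 − cos θ_{(0;0,1)}⟩_{Λ_{M+1},β}`.
[folklore] -/
theorem torusPlaqSinSq_le (β : ℝ) (M : ℕ) :
    wilsonExpectation (L := M + 1) u1Rep β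
        (toTorusObservable (M + 1) (fun U : LGConfig 4 Circle => u1PlaqIm 0 0 1 U * u1PlaqIm 0 0 1 U)) ≤
      2 * wilsonExpectation (L := M + 1) u1Rep β
        (SoloBlind.plaquetteCost u1Rep (0 : Site 4 (M + 1)) 0 1) := by
  haveI := isProbabilityMeasure_wilsonMeasure (d := 4) (L := M + 1) (G := Circle) u1Rep
    continuous_u1Rep β
  have hc : Continuous fun z : Circle => ((z : ℂ)).re :=
    Complex.continuous_re.comp continuous_subtype_val
  have hX : Integrable (fun U : GaugeConfig 4 (M + 1) Circle =>
      ((plaquetteHolonomy U (0 : Site 4 (M + 1)) 0 1 : Circle) : ℂ).re) (wilsonMeasure u1Rep β) := by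
    refine Integrable.of_bound (C := 1) ?_ (ae_of_all _ fun U => ?_)
    · exact (hc.measurable.comp
        (measurable_plaquetteHolonomy (0 : Site 4 (M + 1)) 0 1)).aestronglyMeasurable
    · rw [Real.norm_eq_abs]
      exact (Complex.abs_re_le_norm _).trans (le_of_eq (Circle.norm_coe _))
  simp only [wilsonExpectation]
  rw [← integral_const_mul]
  simp only [toTorusObservable_apply, u1PlaqIm, plaquette_torusLift,
    Literature.MathematicalPhysics.QuantumFieldTheory.torusProj_zero, SoloBlind.plaquetteCost,
    trace_u1Rep_re, Nat.cast_one]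
  refine integral_mono_of_nonneg (ae_of_all _ fun U => mul_self_nonneg _)
    (((integrable_const _).sub hX).const_mul 2) (ae_of_all _ fun U => ?_)
  have := circle_im_sq_le (plaquetteHolonomy U (0 : Site 4 (M + 1)) 0 1)
  simpa [sq] using this

/-- **The torus form, uniform in the volume**: for every `ε > 0` there is `β₁` such that for every
`β > β₁`, `2β⟨sin²θ_{(0;0,1)}⟩_{Λ_{M+1},β} ≤ 1 + ε` for all large `M`. [folklore] -/
theorem torusPlaqSinSq_eventually_le :
    ∀ ε : ℝ, 0 < ε → ∃ β₁ : ℝ, ∀ β : ℝ, β₁ < β → ∀ᶠ M : ℕ in atTop,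
      2 * β * wilsonExpectation (L := M + 1) u1Rep β
        (toTorusObservable (M + 1) (fun U : LGConfig 4 Circle => u1PlaqIm 0 0 1 U * u1PlaqIm 0 0 1 U)) ≤
          1 + ε := by
  intro ε hε
  have hsp := SoloBlind.weakCoupling_singlePlaquette (d := 4) u1Rep (by norm_num) le_rfl
    isUnitaryModel_u1Rep (ε / 4) (by positivity)
  obtain ⟨β₁, hβ₁⟩ := Filter.eventually_atTop.1 hsp
  refine ⟨max β₁ 0, fun β hb => ?_⟩
  have hb1 : β₁ ≤ β := le_trans (le_max_left _ _) hb.le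
  have hb0 : 0 < β := lt_of_le_of_lt (le_max_right _ _) hb
  filter_upwards [hβ₁ β hb1] with M hM
  have h := (abs_le.1 (hM (0 : Site 4 (M + 1)) 0 1 (by decide))).2
  have hle := torusPlaqSinSq_le β M
  -- `2β ⟨sin²⟩ ≤ 4β ⟨1 − cos⟩ ≤ 4 (1/4 + ε/4) = 1 + ε`
  have h4 : 2 * β * wilsonExpectation (L := M + 1) u1Rep β
      (toTorusObservable (M + 1) (fun U : LGConfig 4 Circle => u1PlaqIm 0 0 1 U * u1PlaqIm 0 0 1 U)) ≤
      4 * (β * wilsonExpectation (L := M + 1) u1Rep β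
        (SoloBlind.plaquetteCost u1Rep (0 : Site 4 (M + 1)) 0 1)) :=
    calc 2 * β * wilsonExpectation (L := M + 1) u1Rep β
          (toTorusObservable (M + 1) (fun U : LGConfig 4 Circle => u1PlaqIm 0 0 1 U * u1PlaqIm 0 0 1 U))
        ≤ 2 * β * (2 * wilsonExpectation (L := M + 1) u1Rep β
          (SoloBlind.plaquetteCost u1Rep (0 : Site 4 (M + 1)) 0 1)) :=
          mul_le_mul_of_nonneg_left hle (by positivity)
      _ = 4 * (β * wilsonExpectation (L := M + 1) u1Rep β
          (SoloBlind.plaquetteCost u1Rep (0 : Site 4 (M + 1)) 0 1)) := by ring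
  norm_num at h
  linarith

variable {β : ℝ} {μ : Measure (LGConfig 4 Circle)}

/-- Along the defining subsequence of a limit state, the torus second moments `⟨sin²θ_{(0;0,1)}⟩_{Λ_{φ(k)+1},β}`
converge to `⟨sin²θ_{(0;0,1)}⟩_μ = U1Helicity.plaqCorr μ 0 0 1`. [folklore] -/
theorem tendsto_torusPlaqSinSq {φ : ℕ → ℕ} (hlim : IsInfiniteVolumeLimitAlong (d := 4) u1Rep β φ μ) :
    Tendsto (fun k : ℕ => wilsonExpectation (L := φ k + 1) u1Rep β
        (toTorusObservable (φ k + 1) (fun U : LGConfig 4 Circle => u1PlaqIm 0 0 1 U * u1PlaqIm 0 0 1 U)))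
      atTop (𝓝 (plaqCorr μ 0 0 1)) := by
  obtain ⟨_, hconv⟩ := hlim
  exact hconv (fun U => u1PlaqIm 0 0 1 U * u1PlaqIm 0 0 1 U)
    (Plaq.bonds ((0 : Literature.Probability.LatticeModels.Site 4), (0 : Fin 4), (1 : Fin 4)) ∪
      Plaq.bonds ((0 : Literature.Probability.LatticeModels.Site 4), (0 : Fin 4), (1 : Fin 4)))
    (by rw [IsCylinder, Finset.coe_union]
        exact AreaLaw.dependsOn_mul (dependsOn_u1PlaqIm _ _ _) (dependsOn_u1PlaqIm _ _ _))
    ((continuous_u1PlaqIm _ _ _).mul (continuous_u1PlaqIm _ _ _))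
    ⟨1, fun U => by
      rw [abs_mul]
      exact mul_le_one₀ (abs_u1PlaqIm_le _ _ _ U) (abs_nonneg _) (abs_u1PlaqIm_le _ _ _ U)⟩

/-- **Upper half of the crux `WilsonU1PlaquetteSecondMomentD4`, proved**: for every `ε > 0` there is
`β₁` such that every infinite-volume torus limit state `μ` of Wilson `U(1)₄` at `β > β₁` satisfies
`2β·⟨sin²θ_{(0;0,1)}⟩_μ ≤ 1 + ε`, i.e. `2β · U1Helicity.plaqCorr μ 0 0 1 ≤ 1 + ε`. This is the
inequality the route's ε-budget uses; the matching lower bound is the open content of the crux.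
[folklore] -/
theorem wilsonU1PlaquetteSecondMoment_upper :
    ∀ ε : ℝ, 0 < ε → ∃ β₁ : ℝ, ∀ β : ℝ, β₁ < β →
      ∀ μ ∈ infiniteVolumeLimitPoints (d := 4) u1Rep β, 2 * β * plaqCorr μ 0 0 1 ≤ 1 + ε := by
  intro ε hε
  obtain ⟨β₁, hβ₁⟩ := torusPlaqSinSq_eventually_le ε hε
  refine ⟨β₁, fun β hb μ hμ => ?_⟩
  obtain ⟨φ, hφ, hlim⟩ := hμ
  have ht := (tendsto_torusPlaqSinSq hlim).const_mul (2 * β)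
  refine le_of_tendsto ht ?_
  exact hφ.tendsto_atTop.eventually (hβ₁ β hb)

/-- The same with the absolute value on the side the crux states it, as a ONE-SIDED consequence:
`2β·⟨sin²θ_p⟩_μ − 1 ≤ ε`. [folklore] -/
theorem wilsonU1PlaquetteSecondMoment_sub_one_le :
    ∀ ε : ℝ, 0 < ε → ∃ β₁ : ℝ, ∀ β : ℝ, β₁ < β →
      ∀ μ ∈ infiniteVolumeLimitPoints (d := 4) u1Rep β, 2 * β * plaqCorr μ 0 0 1 - 1 ≤ ε := by
  intro ε hε
  obtain ⟨β₁, hβ₁⟩ := wilsonU1PlaquetteSecondMoment_upper ε hε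
  exact ⟨β₁, fun β hb μ hμ => by linarith [hβ₁ β hb μ hμ]⟩

end Summit.QuantumFields.YangMills.Theorems.U1DipoleHelicity
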